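import Mathlib
import Summits.ValiantsHypothesis.ValiantsHypothesis.Theorems.RigidityForcesSymmetryRankRigidMinimalReprLaplaceFiveSeparatedCaptureTwoLines
import Summits.ValiantsHypothesis.ValiantsHypothesis.Theorems.RigidityForcesSymmetryRankRigidMinimalReprLaplaceFiveSeparatedCaptureReduction
import Summits.ValiantsHypothesis.ValiantsHypothesis.Theorems.RigidityForcesSymmetryRankRigidMinimalReprLaplaceFiveSeparatedCaptureSpanTools

/-!
# ValiantsHypothesis / RigidityForcesSymmetry — crux `LaplaceOptimalFive` (stmt-ValiantsHypothesis-24813), symmetric capture: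
# ★★ **THE TWO-PENCIL BOUND FOR SPANS WITH TRIVIAL TRIPLE INTERSECTION**
# (`U₀₁ ⊓ U₀₂ ⊓ U₁₂ = ⊥ ⇒ finrank W ≤ finrank (U₀₁ ⊔ U₀₂)⁽¹⁾ + finrank (U₀₁ ⊔ U₁₂)⁽¹⁾`)

val-lit-p6 g18 (2026-08-29), the pencil mechanism of ✓ `finrank_le_prolong_of_disjoint` (G) and ✓ N1 (`…LineInTwoPlanes`)
run with BOTH pencils and no projection: by ✓ `L3_finite_form` an obligation reads `T_μ = A_r(p,q) + B_q(p,r) + C_p(q,r)`; the slot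
symmetries `(2 3)` (with `C_p` symmetric) and `(1 3)` (with `B_q` symmetric) make `G₁ := (A_x − B_x)_x ∈ prolong (U₀₁ ⊔ U₀₂)` and
`G₂ := (A_x − C_x)_x ∈ prolong (U₀₁ ⊔ U₁₂)` fully symmetric, and `T_μ = Sym(A) − G₁ − G₂`.  If `U₀₁ ⊓ U₀₂ ⊓ U₁₂ = ⊥` the pair
`(G₁, G₂)` DETERMINES `A` (from `G₁ = G₂ = 0`: `A_x = B_x = C_x ∈ U₀₁ ⊓ U₀₂ ⊓ U₁₂`), hence the obligation; counting on the
representation space (✓ `finrank_map_le_add`, ✓ `hub_injective`) gives the bound.  Consequence: `(SC)` = `CaptureIneqSym`'s clause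
for every «triangle» of three planes with trivial triple intersection inside a 3-space `X` whose prolongation has `finrank ≤ 3`
(`2·3 = 6 = Σ finranks`); by ✓ `finrank_prolong_le_four` only the 3-spaces with a 4-dimensional prolongation (the binary nets
`Sym²⟨ℓ,m⟩`, conjecturally exactly) are left in the triangle family.  Located numerics: `pub/val-lit/lmr/NOTE-p6g18-24813-222flat-located.md`.

* ★★ `finrank_le_prolong_add_prolong_of_inf_eq_bot` — the two-pencil bound.
* ★ `captureIneqSym_of_triple_free_of_prolong_le_three` — `(SC)` for three spans of total finrank `≥ 6` with trivial triple
  intersection inside a space `X` with `finrank (prolong X) ≤ 3`.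

Honest framing.  Partial results toward the OPEN profile `(2,2,2)♭` (triangle with binary ambient net, two-equal-plus-line, common
line remain OPEN), `CaptureIneqSym` in general, K1 on `K₃ ⊔ K₂`, `LaplaceOptimalFive` (OPEN · CONTESTED 72/120), `RankRigidMinimalRepr`
and `VP ≠ VNP` are NOT proved here.  No definitions, no `sorry`.
-/

set_option linter.dupNamespace false
set_option autoImplicit false

namespace Summit.ValiantsHypothesis.ValiantsHypothesis.Theorems.RigidityForcesSymmetryRankRigidMinimalRepr

namespace LaplaceFiveSeparatedCapture

open Finset

/-- ★★ **TWO-PENCIL BOUND.**  `U₀₁, U₀₂, U₁₂` symmetric with `U₀₁ ⊓ U₀₂ ⊓ U₁₂ = ⊥`, `W` symmetric zero-diagonal captured by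
`L3 U₀₁ U₀₂ U₁₂` ⇒ `finrank W ≤ finrank (prolong (U₀₁ ⊔ U₀₂)) + finrank (prolong (U₀₁ ⊔ U₁₂))`. [folklore] -/
theorem finrank_le_prolong_add_prolong_of_inf_eq_bot (U01 U02 U12 W : Submodule ℂ (Fin 5 → Fin 5 → ℂ))
    (h01 : ∀ x ∈ U01, ∀ p q : Fin 5, x p q = x q p) (h02 : ∀ x ∈ U02, ∀ p q : Fin 5, x p q = x q p)
    (h12 : ∀ x ∈ U12, ∀ p q : Fin 5, x p q = x q p) (hbot : U01 ⊓ U02 ⊓ U12 = ⊥)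
    (hWs : ∀ μ ∈ W, ∀ s t : Fin 5, μ s t = μ t s) (hWd : ∀ μ ∈ W, ∀ s : Fin 5, μ s s = 0)
    (hWc : ∀ μ ∈ W, contractZ μ ∈ L3 U01 U02 U12) :
    Module.finrank ℂ W ≤ Module.finrank ℂ (prolong (U01 ⊔ U02)) + Module.finrank ℂ (prolong (U01 ⊔ U12)) := by
  classical
  -- representation space `E ∋ (Ã, (G₁, G₂))` with `Ã p q r = A_r(p,q)`; assembly `Φ = Sym(A) − G₁ − G₂`; projections `π₁, π₂`
  let symA : (Fin 5 → Fin 5 → Fin 5 → ℂ) →ₗ[ℂ] (Fin 5 → Fin 5 → Fin 5 → ℂ) :=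
    { toFun := fun A p q r => A p q r + A p r q + A q r p
      map_add' := fun A B => by
        funext p q r
        simp only [Pi.add_apply]
        ring
      map_smul' := fun c A => by
        funext p q r
        simp only [Pi.smul_apply, smul_eq_mul, RingHom.id_apply]
        ring }
  let pA : ((Fin 5 → Fin 5 → Fin 5 → ℂ) × ((Fin 5 → Fin 5 → Fin 5 → ℂ) × (Fin 5 → Fin 5 → Fin 5 → ℂ))) →ₗ[ℂ] (Fin 5 → Fin 5 → Fin 5 → ℂ) :=
    LinearMap.fst ℂ _ _
  let π₁ : ((Fin 5 → Fin 5 → Fin 5 → ℂ) × ((Fin 5 → Fin 5 → Fin 5 → ℂ) × (Fin 5 → Fin 5 → Fin 5 → ℂ))) →ₗ[ℂ] (Fin 5 → Fin 5 → Fin 5 → ℂ) :=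
    (LinearMap.fst ℂ _ _).comp (LinearMap.snd ℂ _ _)
  let π₂ : ((Fin 5 → Fin 5 → Fin 5 → ℂ) × ((Fin 5 → Fin 5 → Fin 5 → ℂ) × (Fin 5 → Fin 5 → Fin 5 → ℂ))) →ₗ[ℂ] (Fin 5 → Fin 5 → Fin 5 → ℂ) :=
    (LinearMap.snd ℂ _ _).comp (LinearMap.snd ℂ _ _)
  let Φ : ((Fin 5 → Fin 5 → Fin 5 → ℂ) × ((Fin 5 → Fin 5 → Fin 5 → ℂ) × (Fin 5 → Fin 5 → Fin 5 → ℂ))) →ₗ[ℂ] (Fin 5 → Fin 5 → Fin 5 → ℂ) :=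
    symA.comp pA - π₁ - π₂
  have hΦ : ∀ (x : ((Fin 5 → Fin 5 → Fin 5 → ℂ) × ((Fin 5 → Fin 5 → Fin 5 → ℂ) × (Fin 5 → Fin 5 → Fin 5 → ℂ)))) (p q r : Fin 5),
      Φ x p q r = x.1 p q r + x.1 p r q + x.1 q r p - x.2.1 p q r - x.2.2 p q r := fun x p q r => rfl
  have hπ₁ : ∀ x : ((Fin 5 → Fin 5 → Fin 5 → ℂ) × ((Fin 5 → Fin 5 → Fin 5 → ℂ) × (Fin 5 → Fin 5 → Fin 5 → ℂ))), π₁ x = x.2.1 :=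
    fun x => rfl
  have hπ₂ : ∀ x : ((Fin 5 → Fin 5 → Fin 5 → ℂ) × ((Fin 5 → Fin 5 → Fin 5 → ℂ) × (Fin 5 → Fin 5 → Fin 5 → ℂ))), π₂ x = x.2.2 :=
    fun x => rfl
  -- slices `A_r = Ã(·,·,r)` and the differences `A_x − (G_i)_x` as linear maps
  let sL : Fin 5 → ((Fin 5 → Fin 5 → Fin 5 → ℂ) →ₗ[ℂ] (Fin 5 → Fin 5 → ℂ)) := fun r =>
    { toFun := fun A p q => A p q r, map_add' := fun _ _ => rfl, map_smul' := fun _ _ => rfl }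
  let d₁ : Fin 5 → (((Fin 5 → Fin 5 → Fin 5 → ℂ) × ((Fin 5 → Fin 5 → Fin 5 → ℂ) × (Fin 5 → Fin 5 → Fin 5 → ℂ))) →ₗ[ℂ] (Fin 5 → Fin 5 → ℂ)) :=
    fun x => (sL x).comp pA - (LinearMap.proj x).comp π₁
  let d₂ : Fin 5 → (((Fin 5 → Fin 5 → Fin 5 → ℂ) × ((Fin 5 → Fin 5 → Fin 5 → ℂ) × (Fin 5 → Fin 5 → Fin 5 → ℂ))) →ₗ[ℂ] (Fin 5 → Fin 5 → ℂ)) :=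
    fun x => (sL x).comp pA - (LinearMap.proj x).comp π₂
  have hd₁ : ∀ (e : ((Fin 5 → Fin 5 → Fin 5 → ℂ) × ((Fin 5 → Fin 5 → Fin 5 → ℂ) × (Fin 5 → Fin 5 → Fin 5 → ℂ)))) (x : Fin 5),
      d₁ x e = (fun p q => e.1 p q x) - e.2.1 x := fun e x => rfl
  have hd₂ : ∀ (e : ((Fin 5 → Fin 5 → Fin 5 → ℂ) × ((Fin 5 → Fin 5 → Fin 5 → ℂ) × (Fin 5 → Fin 5 → Fin 5 → ℂ)))) (x : Fin 5),
      d₂ x e = (fun p q => e.1 p q x) - e.2.2 x := fun e x => rfl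
  let R : Submodule ℂ ((Fin 5 → Fin 5 → Fin 5 → ℂ) × ((Fin 5 → Fin 5 → Fin 5 → ℂ) × (Fin 5 → Fin 5 → Fin 5 → ℂ))) :=
    ((W.map cZ).comap Φ ⊓ ⨅ r, U01.comap ((sL r).comp pA)) ⊓
      ((⨅ x, U02.comap (d₁ x)) ⊓ (⨅ x, U12.comap (d₂ x))) ⊓
      ((prolong (U01 ⊔ U02)).comap π₁ ⊓ (prolong (U01 ⊔ U12)).comap π₂)
  have hR : ∀ e : ((Fin 5 → Fin 5 → Fin 5 → ℂ) × ((Fin 5 → Fin 5 → Fin 5 → ℂ) × (Fin 5 → Fin 5 → Fin 5 → ℂ))), e ∈ R ↔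
      ((Φ e ∈ W.map cZ ∧ ∀ r, (fun p q => e.1 p q r) ∈ U01) ∧
        ((∀ x, d₁ x e ∈ U02) ∧ ∀ x, d₂ x e ∈ U12)) ∧
      (π₁ e ∈ prolong (U01 ⊔ U02) ∧ π₂ e ∈ prolong (U01 ⊔ U12)) := by
    intro e
    simp only [R, Submodule.mem_inf, Submodule.mem_comap, Submodule.mem_iInf, LinearMap.comp_apply]
    exact Iff.rfl
  -- `(G₁, G₂)` determine the representation: `π₁ e = π₂ e = 0 ⇒ e = 0` on `R`
  have hρ : ∀ e ∈ R, π₁ e = 0 → π₂ e = 0 → e = 0 := by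
    intro e he h1 h2
    obtain ⟨⟨⟨-, hA⟩, hB, hC⟩, -⟩ := (hR e).mp he
    rw [hπ₁] at h1
    rw [hπ₂] at h2
    have hz : ∀ r, (fun p q => e.1 p q r) = 0 := fun r => by
      have m2 : (fun p q => e.1 p q r) ∈ U02 := by
        have := hB r
        rw [hd₁, h1, Pi.zero_apply, sub_zero] at this
        exact this
      have m3 : (fun p q => e.1 p q r) ∈ U12 := by
        have := hC r
        rw [hd₂, h2, Pi.zero_apply, sub_zero] at this
        exact this
      have hmem : (fun p q => e.1 p q r) ∈ U01 ⊓ U02 ⊓ U12 :=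
        Submodule.mem_inf.mpr ⟨Submodule.mem_inf.mpr ⟨hA r, m2⟩, m3⟩
      rw [hbot] at hmem
      exact (Submodule.mem_bot ℂ).mp hmem
    refine Prod.ext ?_ (Prod.ext h1 h2)
    funext p q r
    show e.1 p q r = 0
    have := congrFun (congrFun (hz r) p) q
    simpa using this
  -- every obligation lies in `Φ(R)`: the two pencils of the finite form
  have hmem : ∀ μ ∈ W, contractZ μ ∈ R.map Φ := by
    intro μ hμ
    obtain ⟨A, B, C, hA, hB, hC, hT⟩ := L3_finite_form U01 U02 U12 (hWc μ hμ)
    let G₁ : Fin 5 → Fin 5 → Fin 5 → ℂ := fun x y z => A x y z - B x y z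
    let G₂ : Fin 5 → Fin 5 → Fin 5 → ℂ := fun x y z => A x y z - C x y z
    have hGd₁ : ∀ x y z, G₁ x y z = A x y z - B x y z := fun _ _ _ => rfl
    have hGd₂ : ∀ x y z, G₂ x y z = A x y z - C x y z := fun _ _ _ => rfl
    have hG23₁ : ∀ x y z, G₁ x y z = G₁ x z y := fun x y z => by
      rw [hGd₁, hGd₁, h01 _ (hA x) y z, h02 _ (hB x) y z]
    have hG23₂ : ∀ x y z, G₂ x y z = G₂ x z y := fun x y z => by
      rw [hGd₂, hGd₂, h01 _ (hA x) y z, h12 _ (hC x) y z]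
    have hG13₁ : ∀ x y z, G₁ x y z = G₁ z y x := fun x y z => by
      have h := contractZ_swap23 μ y x z
      rw [hT, hT] at h
      have hc := h12 _ (hC y) z x
      rw [hGd₁, hGd₁]
      linear_combination h - hc
    have hG13₂ : ∀ x y z, G₂ x y z = G₂ z y x := fun x y z => by
      have h : contractZ μ z y x = contractZ μ x y z := by
        rw [contractZ_swap12 μ y z x, contractZ_swap23 μ y x z, contractZ_swap12 μ x y z]
      rw [hT, hT] at h
      have hb := h02 _ (hB y) z x
      have ha1 := h01 _ (hA x) z y
      have ha2 := h01 _ (hA z) x y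
      rw [hGd₂, hGd₂]
      linear_combination h - hb - ha1 + ha2
    have hG12₁ : ∀ x y z, G₁ x y z = G₁ y x z := fun x y z => by rw [hG23₁ y x z, hG13₁ y z x, hG23₁ x z y]
    have hG12₂ : ∀ x y z, G₂ x y z = G₂ y x z := fun x y z => by rw [hG23₂ y x z, hG13₂ y z x, hG23₂ x z y]
    have hGp₁ : G₁ ∈ prolong (U01 ⊔ U02) := by
      refine (mem_prolong_iff _ G₁).mpr ⟨hG12₁, hG23₁, fun x => ?_⟩
      have e : G₁ x = A x - B x := by funext y z; rw [hGd₁, Pi.sub_apply, Pi.sub_apply]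
      rw [e]
      exact Submodule.sub_mem _ (Submodule.mem_sup_left (hA x)) (Submodule.mem_sup_right (hB x))
    have hGp₂ : G₂ ∈ prolong (U01 ⊔ U12) := by
      refine (mem_prolong_iff _ G₂).mpr ⟨hG12₂, hG23₂, fun x => ?_⟩
      have e : G₂ x = A x - C x := by funext y z; rw [hGd₂, Pi.sub_apply, Pi.sub_apply]
      rw [e]
      exact Submodule.sub_mem _ (Submodule.mem_sup_left (hA x)) (Submodule.mem_sup_right (hC x))
    let e : ((Fin 5 → Fin 5 → Fin 5 → ℂ) × ((Fin 5 → Fin 5 → Fin 5 → ℂ) × (Fin 5 → Fin 5 → Fin 5 → ℂ))) :=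
      ((fun p q r => A r p q), (G₁, G₂))
    have hrep : Φ e = contractZ μ := by
      funext p q r
      rw [hΦ, hT p q r]
      show A r p q + A q p r + A p q r - G₁ p q r - G₂ p q r = A r p q + B q p r + C p q r
      rw [hG12₁ p q r, hGd₁, hGd₂]
      ring
    refine Submodule.mem_map.mpr ⟨e, (hR e).mpr ⟨⟨⟨?_, fun r => hA r⟩, fun x => ?_, fun x => ?_⟩, ?_, ?_⟩, hrep⟩
    · rw [hrep]; exact Submodule.mem_map.mpr ⟨μ, hμ, cZ_apply μ⟩
    · have ex : d₁ x e = B x := by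
        rw [hd₁]; funext p q
        show A x p q - G₁ x p q = B x p q
        rw [hGd₁]; ring
      rw [ex]; exact hB x
    · have ex : d₂ x e = C x := by
        rw [hd₂]; funext p q
        show A x p q - G₂ x p q = C x p q
        rw [hGd₂]; ring
      rw [ex]; exact hC x
    · exact hGp₁
    · exact hGp₂
  -- counting
  let f : W →ₗ[ℂ] (R.map Φ) := LinearMap.codRestrict (R.map Φ) (cZ.domRestrict W) (fun μ => by
    simpa [cZ_apply] using hmem μ.1 μ.2)
  have hf : Function.Injective f := by
    rw [injective_iff_map_eq_zero]
    intro μ hμ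
    have hT : contractZ μ.1 = 0 := by
      have := congrArg Subtype.val hμ
      simpa [f, cZ_apply] using this
    apply Subtype.ext
    refine hub_injective μ.1 (hWs μ.1 μ.2) (hWd μ.1 μ.2) fun p q => ?_
    simp [hT]
  have h1 := LinearMap.finrank_le_finrank_of_injective hf
  have h2 := finrank_map_le_add Φ π₁ π₂ R hρ
  have h3 : Module.finrank ℂ (R.map π₁) ≤ Module.finrank ℂ (prolong (U01 ⊔ U02)) :=
    Submodule.finrank_mono (Submodule.map_le_iff_le_comap.mpr fun e he => ((hR e).mp he).2.1)
  have h4 : Module.finrank ℂ ((R ⊓ LinearMap.ker π₁).map π₂) ≤ Module.finrank ℂ (prolong (U01 ⊔ U12)) :=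
    Submodule.finrank_mono (Submodule.map_le_iff_le_comap.mpr fun e he =>
      ((hR e).mp (Submodule.mem_inf.mp he).1).2.2)
  omega

/-- ★ **`(SC)` FOR THREE SPANS WITH TRIVIAL TRIPLE INTERSECTION IN A SPACE WITH SMALL PROLONGATION.**  If moreover
`U₀₁ ⊔ U₀₂, U₀₁ ⊔ U₁₂ ≤ X` with `finrank (prolong X) ≤ 3` and the three finranks total `≥ 6` (e.g. a «triangle» of three planes in
a 3-space `X` that is not a binary net), the capture inequality holds. [folklore] -/
theorem captureIneqSym_of_triple_free_of_prolong_le_three (U01 U02 U12 W X : Submodule ℂ (Fin 5 → Fin 5 → ℂ))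
    (h01 : ∀ x ∈ U01, ∀ p q : Fin 5, x p q = x q p) (h02 : ∀ x ∈ U02, ∀ p q : Fin 5, x p q = x q p)
    (h12 : ∀ x ∈ U12, ∀ p q : Fin 5, x p q = x q p) (hbot : U01 ⊓ U02 ⊓ U12 = ⊥)
    (hX2 : U01 ⊔ U02 ≤ X) (hX3 : U01 ⊔ U12 ≤ X) (hpX : Module.finrank ℂ (prolong X) ≤ 3)
    (h6 : 6 ≤ Module.finrank ℂ U01 + Module.finrank ℂ U02 + Module.finrank ℂ U12)
    (hWs : ∀ μ ∈ W, ∀ s t : Fin 5, μ s t = μ t s) (hWd : ∀ μ ∈ W, ∀ s : Fin 5, μ s s = 0)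
    (hWc : ∀ μ ∈ W, contractZ μ ∈ L3 U01 U02 U12) :
    Module.finrank ℂ W ≤ Module.finrank ℂ U01 + Module.finrank ℂ U02 + Module.finrank ℂ U12 := by
  have h := finrank_le_prolong_add_prolong_of_inf_eq_bot U01 U02 U12 W h01 h02 h12 hbot hWs hWd hWc
  have e2 := Submodule.finrank_mono (prolong_mono hX2)
  have e3 := Submodule.finrank_mono (prolong_mono hX3)
  omega

end LaplaceFiveSeparatedCapture

end Summit.ValiantsHypothesis.ValiantsHypothesis.Theorems.RigidityForcesSymmetryRankRigidMinimalRepr
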